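import Mathlib
import Summits.ResolutionOfSingularities.ResolutionOfSingularities.Theorems.PAlterationPicoverLocalModelSingularLocus
import Summits.ResolutionOfSingularities.ResolutionOfSingularities.Theorems.PAlterationPicoverTowerTransport

/-!
# Sketch — stub-ideation k3 for `stub_picoverDegP` (crux `Picover`, stmt-ResolutionOfSingularities-0554)

Elaboration sanity of the helper-lemma STATEMENTS proposed in
`STUB-IDEAS-stub_picoverDegP-3.md` (all `sorry`; nothing here is claimed proved).
-/

noncomputable section

open Polynomial IsLocalRing CategoryTheory AlgebraicGeometry
open Literature.AlgebraicGeometry.Resolution Literature.AlgebraicGeometry.Motives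

set_option linter.dupNamespace false

universe u

namespace Summit.ResolutionOfSingularities.ResolutionOfSingularities.Cruxes.Picover.StubIdeas3

/-- **H1 (forcing at a singular point = converse of the landed transversal/wound exits).**
`R` regular local of characteristic `p`, `S ⊇ R` a finite integrally closed domain of generic rank
`p` with `S^p ⊆ R` (the stalk of `normalizationIn W L` over `w`). Then `S` is regular iff the class
has a GOOD representative `h = s^p ∈ R`, `s ∉ R`, with `h ∉ R^p + 𝔪²`. (⇐ is landed:
`isRegularLocalRing_adjoinRoot_of_transversal/_of_wound` + normality; ⇒ is Kimura–Niitsuma /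
Aramova–Avramov for index `p`.) Contrapositive = what a minimal counterexample is forced to look
like at each of its singular points: EVERY representative is a `p`-th power modulo `𝔪_w²`. -/
theorem isRegularRing_iff_exists_good_representative {p : ℕ} [Fact p.Prime]
    {R : Type u} [CommRing R] [IsRegularLocalRing R] [CharP R p]
    {S : Type u} [CommRing S] [IsDomain S] [Algebra R S] [Module.Finite R S] [FaithfulSMul R S]
    [IsIntegrallyClosed S]
    (hrank : Module.finrank R S = p) (hrad : ∀ s : S, s ^ p ∈ (algebraMap R S).range) :
    IsRegularRing S ↔
      ∃ h : R, (∃ s : S, s ^ p = algebraMap R S h ∧ s ∉ (algebraMap R S).range) ∧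
        ∀ c : R, h - c ^ p ∉ maximalIdeal R ^ 2 := by
  sorry

/-- **H1-cor (residue field and multiplicity at a singular point).** Under the hypotheses of H1,
if `S` is NOT regular then `S` is local with the same residue field as `R` (purely inseparable
residue extension of degree `1`); informally also `e(S) ≤ p`. -/
theorem residue_bijective_of_not_isRegularRing {p : ℕ} [Fact p.Prime]
    {R : Type u} [CommRing R] [IsRegularLocalRing R] [CharP R p]
    {S : Type u} [CommRing S] [IsDomain S] [IsLocalRing S] [Algebra R S] [Module.Finite R S]
    [FaithfulSMul R S] [IsIntegrallyClosed S] [IsLocalHom (algebraMap R S)]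
    (hrank : Module.finrank R S = p) (hrad : ∀ s : S, s ^ p ∈ (algebraMap R S).range)
    (hsing : ¬ IsRegularRing S) :
    Function.Bijective (ResidueField.map (algebraMap R S)) := by
  sorry

/-- **H2 (base-driven transfer; glue, essentially landed).** If some proper birational `ρ : W' → W`
from a REGULAR `W'` makes the normalization of `W'` in `L` regular, then `normalizationIn W L` has a
resolution. (`TowerTransport.hasResolution_normalizationIn_of_isProper` + `IsRegular.hasResolution`.) -/
theorem hasResolution_normalizationIn_of_baseDriven
    (hK0 : ∀ (W : Scheme.{0}) [IsIntegral W] (L : Type) [Field L] [Algebra W.functionField L]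
      [FiniteDimensional W.functionField L], ∃ e : (normalizationIn W L).functionField ≃+* L,
        e.toRingHom.comp (RatFn.functionFieldMap (normalizationInι W L)) =
          algebraMap W.functionField L)
    {k : Type} [Field k] (W : Scheme.{0}) [IsIntegral W] (f : W ⟶ Spec (.of k))
    [LocallyOfFiniteType f] (L : Type) [Field L] [Algebra W.functionField L]
    [FiniteDimensional W.functionField L] (W' : Scheme.{0}) [IsIntegral W']
    [Algebra W'.functionField L] [FiniteDimensional W'.functionField L] (ρ : W' ⟶ W) [IsProper ρ]
    [IsDominant ρ]
    (hcompat : (algebraMap W'.functionField L).comp (RatFn.functionFieldMap ρ) =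
      algebraMap W.functionField L)
    (hfib : ∀ w' : W', ρ w' = genericPoint W → w' = genericPoint W')
    (hreg : Scheme.IsRegular (normalizationIn W' L)) :
    Scheme.HasResolution (normalizationIn W L) :=
  Summit.ResolutionOfSingularities.ResolutionOfSingularities.Theorems.Picover.TowerTransport.hasResolution_normalizationIn_of_isProper
    hK0 W f L W' ρ hcompat hfib hreg.hasResolution

/-- **H3 (`p = 2`: Morse points die under ONE blow-up of the base; first tooth of the Hirokado
engine in dimension `d`).** `R` regular local of characteristic `2` with regular system of
parameters `x` and dual derivations `D`; `g ∈ 𝔪²` a representative of the class at a singular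
point (exists by H1) whose polar form `B = (D_i D_j g)(w)` (alternating in char `2`, independent of
the square ambiguity) is NON-DEGENERATE. Then in the `x_{i₀}`-chart `R₁ = R[x_j / x_{i₀}]` of the
blow-up of `𝔪`, `g = x_{i₀}² g₁` and at EVERY point `𝔮` of the exceptional divisor some derivation
of `R₁` does not kill `g₁` modulo `𝔮` — so `R₁[T]/(T² - g₁)` is regular over `𝔮` by the landed
`isRegularLocalRing_localModel_of_derivation`. (General `B`: the bad points of the chart lie in
`ℙ(rad B)`.) -/
theorem morse_dies_in_one_blowup_char_two
    {R : Type u} [CommRing R] [IsDomain R] [IsRegularLocalRing R] [CharP R 2]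
    {d : ℕ} (x : Fin d → R) (hx : Ideal.span (Set.range x) = maximalIdeal R)
    (hd : (d : WithBot ℕ∞) = ringKrullDim R)
    (D : Fin d → Derivation ℤ R R) (hD : ∀ i j, D i (x j) = if i = j then 1 else 0)
    (g : R) (hg : g ∈ maximalIdeal R ^ 2)
    (hB : IsUnit (Matrix.det (Matrix.of fun i j : Fin d => residue R (D i (D j g)))))
    (K : Type u) [Field K] [Algebra R K] [IsFractionRing R K] (i₀ : Fin d)
    (R₁ : Subalgebra R K)
    (hR₁ : R₁ = Algebra.adjoin R (Set.range fun j : Fin d =>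
      algebraMap R K (x j) / algebraMap R K (x i₀))) :
    ∃ g₁ : R₁, algebraMap R K g = algebraMap R K (x i₀) ^ 2 * (g₁ : K) ∧
      ∀ 𝔮 : Ideal R₁, 𝔮.IsPrime → algebraMap R R₁ (x i₀) ∈ 𝔮 →
        ∃ D₁ : Derivation ℤ R₁ R₁, D₁ g₁ ∉ 𝔮 := by
  sorry

/-- **H4 (`p` odd: Morse points are `cA_{p-1}`; resolved by `(p-1)/2` point blow-ups of the
cover).** Same data in characteristic `p ≠ 2`: the local model `R[T]/(T^p - g)` at a point where
the Hessian of the representative `g ∈ 𝔪²` is non-degenerate has a resolution (explicit: blow up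
the closed point, the only non-regular point of the transform is the `T`-direction point, of the
same shape with `p ↦ p - 2`). M-sized; optional. -/
theorem hasResolution_localModel_of_morse_odd {p : ℕ} [Fact p.Prime] (hp : p ≠ 2)
    {R : Type u} [CommRing R] [IsDomain R] [IsRegularLocalRing R] [CharP R p]
    {d : ℕ} (x : Fin d → R) (hx : Ideal.span (Set.range x) = maximalIdeal R)
    (hd : (d : WithBot ℕ∞) = ringKrullDim R)
    (D : Fin d → Derivation ℤ R R) (hD : ∀ i j, D i (x j) = if i = j then 1 else 0)
    (g : R) (hg : g ∈ maximalIdeal R ^ 2)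
    (hB : IsUnit (Matrix.det (Matrix.of fun i j : Fin d => residue R (D i (D j g))))) :
    Scheme.HasResolution (Spec (.of
      (AdjoinRoot ((X : R[X]) ^ p - C g) ⧸ nilradical (AdjoinRoot ((X : R[X]) ^ p - C g))))) := by
  sorry

end Summit.ResolutionOfSingularities.ResolutionOfSingularities.Cruxes.Picover.StubIdeas3

end
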